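import Summits.HubbardSuperconductivity.HubbardSuperconductivity.Theorems.BalabanIRBirComplexStableXYRHessianOrigin
import Literature.MathematicalPhysics.QuantumFieldTheory.TorusChartCochains
import HarnessLib

/-!
# Route `BalabanIR`, crux `BirComplexStableXYR` (item `stmt-HubbardSuperconductivity-14845`),
# line `fat-gaussian-defect-calculus`: stub P1e `stub_thinFormCoercive`

Helper (`--supports`) for the crux
`Summit.HubbardSuperconductivity.HubbardSuperconductivity.Theses.BalabanIR.BirComplexStableXYR`,
line `fat-gaussian-defect-calculus`, stub P1e `stub_thinFormCoercive`: **coercivity of the thin Gaussian form on ALL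
real `1`-cochains** of the space–time torus `Λ L M = (Fin 2 → ZMod L) × ZMod M` (chart
`TorusChart.piProdZMod 2 L M`: directions `0, 1` spatial, `2` temporal).

**Statement.** For a window Fourier table `c : Table r` (`r ≥ 2`) with (N) `Σ_n c_n = 0` and the coercivity (C)
`c₀ ΣΣ (1 − cos(φ_w − φ_w')) ≤ Re F(φ)`, the thin form `𝒬(ω) = Σ_s Q_c(P_s ω)` — where
`Q_c(v) = Re(−Σ_n c_n (n·v)²)` is twice the real window Hessian at the constants and `P_s ω : W r → ℝ` is the window
path configuration of the real `1`-cochain `ω` (staircase line sums from the corner `s`: `w.1` edges in direction `0`,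
then `w.2.1` in direction `1`, then `w.2.2` in direction `2`) — satisfies `2c₀ Σ_{x,i} ω(x,i)² ≤ 𝒬(ω)`.

**Proof.** Fix the corner `s` and put `v := P_s ω`.  The landed window-level second-order condition
`Theorems.cvxr_re_hess_origin_ge` gives `c₀ Σ_w Σ_{w'} (v_w − v_{w'})² ≤ Q_c(v)`.  The path configuration vanishes at
the corner `0 = (0,0,0)` (three empty line sums) and equals `ω(s,i)` at the unit vector `e_i` (one line sum of length
one, the other two empty), so the row and the column of the double sum through the corner contribute
`Σ_w (v_w − 0)² + Σ_{w'} (0 − v_{w'})² ≥ 2 Σ_i ω(s,i)²` (`thinForm_rowCol_le_sum_sum`, `thinForm_three_le_sum`).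
Summing over `s` gives the claim.  Elementary finite-sum bookkeeping; no definition and no named fact is
introduced; sorry-free. [folklore]
-/

set_option linter.dupNamespace false -- `Summit.<S>.<S>.Theorems…` repeats the summit name (D-0017 layout)

namespace Summit.HubbardSuperconductivity.HubbardSuperconductivity.Theorems.FSUnfolding

open scoped BigOperators
open Literature.MathematicalPhysics.QuantumFieldTheory Literature.Probability.LatticeModels
open Summit.HubbardSuperconductivity.BirComplexStableXYNegative

/-- **Row and column through a base point.**  For a non-negative kernel `g` on a finite type vanishing at `(z, z)`,
the row and the column through `z` are together dominated by the full double sum: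
`Σ_w g(w,z) + Σ_{w'} g(z,w') ≤ Σ_w Σ_{w'} g(w,w')`. [folklore] -/
theorem thinForm_rowCol_le_sum_sum {ι : Type*} [Fintype ι] [DecidableEq ι] (g : ι → ι → ℝ)
    (hg : ∀ a b, 0 ≤ g a b) (z : ι) (hzz : g z z = 0) :
    ∑ w, g w z + ∑ w', g z w' ≤ ∑ w, ∑ w', g w w' := by
  have h1 : ∀ w, g w z + ∑ w' ∈ Finset.univ.erase z, g w w' = ∑ w', g w w' :=
    fun w => Finset.add_sum_erase _ _ (Finset.mem_univ z)
  have h2 : ∑ w, ∑ w', g w w' = ∑ w, g w z + ∑ w, ∑ w' ∈ Finset.univ.erase z, g w w' := by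
    rw [← Finset.sum_add_distrib]
    exact Finset.sum_congr rfl fun w _ => (h1 w).symm
  have h3 : ∑ w' ∈ Finset.univ.erase z, g z w' ≤ ∑ w, ∑ w' ∈ Finset.univ.erase z, g w w' :=
    Finset.single_le_sum (f := fun w => ∑ w' ∈ Finset.univ.erase z, g w w')
      (fun w _ => Finset.sum_nonneg fun w' _ => hg w w') (Finset.mem_univ z)
  have h4 : ∑ w', g z w' = ∑ w' ∈ Finset.univ.erase z, g z w' := by
    rw [← h1 z, hzz, zero_add]
  rw [h2, h4]
  linarith

/-- **Three unit vectors of the window.**  For `r ≥ 2` the points `e_0 = (1,0,0)`, `e_1 = (0,1,0)`, `e_2 = (0,0,1)`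
of the window `W_r = Fin r × Fin r × Fin r` are pairwise distinct, so a non-negative function summed over the window
dominates the sum of its three values there. [folklore] -/
theorem thinForm_three_le_sum {r : ℕ} (h1 : 1 < r) (f : W r → ℝ) (hf : ∀ w, 0 ≤ f w) :
    f (⟨1, h1⟩, ⟨0, Nat.zero_lt_of_lt h1⟩, ⟨0, Nat.zero_lt_of_lt h1⟩)
      + f (⟨0, Nat.zero_lt_of_lt h1⟩, ⟨1, h1⟩, ⟨0, Nat.zero_lt_of_lt h1⟩)
      + f (⟨0, Nat.zero_lt_of_lt h1⟩, ⟨0, Nat.zero_lt_of_lt h1⟩, ⟨1, h1⟩) ≤ ∑ w, f w := by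
  set a : W r := (⟨1, h1⟩, ⟨0, Nat.zero_lt_of_lt h1⟩, ⟨0, Nat.zero_lt_of_lt h1⟩) with ha
  set b : W r := (⟨0, Nat.zero_lt_of_lt h1⟩, ⟨1, h1⟩, ⟨0, Nat.zero_lt_of_lt h1⟩) with hb
  set e : W r := (⟨0, Nat.zero_lt_of_lt h1⟩, ⟨0, Nat.zero_lt_of_lt h1⟩, ⟨1, h1⟩) with he
  have hab : a ≠ b := by simp [ha, hb]
  have hae : a ≠ e := by simp [ha, he]
  have hbe : b ≠ e := by simp [hb, he]
  have hsub : ({a, b, e} : Finset (W r)) ⊆ Finset.univ := Finset.subset_univ _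
  have h := Finset.sum_le_sum_of_subset_of_nonneg hsub fun w _ _ => hf w
  rw [Finset.sum_insert (by simp [hab, hae]), Finset.sum_pair hbe] at h
  linarith

/-- **Window-level coercivity from four values.**  Under (N) and (C), if a window configuration `V : W_r → ℝ`
(`r ≥ 2`) vanishes at the corner `(0,0,0)` and takes the values `a₀, a₁, a₂` at the unit vectors
`(1,0,0), (0,1,0), (0,0,1)`, then `2c₀ (a₀² + a₁² + a₂²) ≤ Q_c(V) = Re(−Σ_n c_n (n·V)²)`: the second-order condition
`cvxr_re_hess_origin_ge` bounds `Q_c(V)` below by `c₀ ΣΣ (V_w − V_{w'})²`, whose row and column through the corner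
already contain `2 Σ_i a_i²`. [folklore] -/
theorem thinForm_hess_ge_of_values {r : ℕ} (c : Table r) {c₀ : ℝ} (h1 : 1 < r) (hc₀ : 0 < c₀)
    (hN : c.sum (fun _ a => a) = 0)
    (hC : ∀ φ : W r → ℝ, c₀ * ∑ w, ∑ w', (1 - Real.cos (φ w - φ w')) ≤ (genF c φ).re)
    (V : W r → ℝ) (a0 a1 a2 : ℝ)
    (hz : V (⟨0, Nat.zero_lt_of_lt h1⟩, ⟨0, Nat.zero_lt_of_lt h1⟩, ⟨0, Nat.zero_lt_of_lt h1⟩) = 0)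
    (he0 : V (⟨1, h1⟩, ⟨0, Nat.zero_lt_of_lt h1⟩, ⟨0, Nat.zero_lt_of_lt h1⟩) = a0)
    (he1 : V (⟨0, Nat.zero_lt_of_lt h1⟩, ⟨1, h1⟩, ⟨0, Nat.zero_lt_of_lt h1⟩) = a1)
    (he2 : V (⟨0, Nat.zero_lt_of_lt h1⟩, ⟨0, Nat.zero_lt_of_lt h1⟩, ⟨1, h1⟩) = a2) :
    2 * c₀ * (a0 ^ 2 + a1 ^ 2 + a2 ^ 2) ≤
      (-c.sum (fun n a => a * (((∑ w, (n w : ℝ) * V w) ^ 2 : ℝ) : ℂ))).re := by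
  have hH := cvxr_re_hess_origin_ge c hc₀ hN hC V
  set z : W r := (⟨0, Nat.zero_lt_of_lt h1⟩, ⟨0, Nat.zero_lt_of_lt h1⟩, ⟨0, Nat.zero_lt_of_lt h1⟩) with hz'
  have hrc := thinForm_rowCol_le_sum_sum (fun w w' => (V w - V w') ^ 2) (fun _ _ => sq_nonneg _) z
    (by simp)
  have h3 := thinForm_three_le_sum h1 (fun w => V w ^ 2) fun _ => sq_nonneg _
  rw [he0, he1, he2] at h3
  simp only [hz, sub_zero, zero_sub, neg_sq] at hrc
  have hlow : 2 * (a0 ^ 2 + a1 ^ 2 + a2 ^ 2) ≤ ∑ w, ∑ w', (V w - V w') ^ 2 := by linarith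
  calc 2 * c₀ * (a0 ^ 2 + a1 ^ 2 + a2 ^ 2) = c₀ * (2 * (a0 ^ 2 + a1 ^ 2 + a2 ^ 2)) := by ring
    _ ≤ c₀ * ∑ w, ∑ w', (V w - V w') ^ 2 := mul_le_mul_of_nonneg_left hlow hc₀.le
    _ ≤ _ := hH

/-- **Stub P1e `stub_thinFormCoercive` (registered signature, verbatim): coercivity of the thin Gaussian form on ALL
real `1`-cochains.**  Under (N) and (C) the summed window Hessian form evaluated on the window path configurations of
an arbitrary real `1`-cochain `ω` of `Λ L M` dominates `2c₀‖ω‖²` (window range `r ≥ 2`): in the window with corner `s`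
the path configuration takes the value `0` at the corner and `ω(s,i)` at the unit vector `e_i`, and the window-level
second-order condition `cvxr_re_hess_origin_ge` gives `Q_c(v) ≥ c₀ ΣΣ (v_w − v_{w'})²`
(`thinForm_hess_ge_of_values`); sum over the corners `s`. [folklore] -/
theorem stub_thinFormCoercive :
    ∀ (r : ℕ) (c : Table r) (c₀ : ℝ), 2 ≤ r → 0 < c₀ → c.sum (fun _ a => a) = 0 →
      (∀ φ : W r → ℝ, c₀ * ∑ w, ∑ w', (1 - Real.cos (φ w - φ w')) ≤ (genF c φ).re) →
      ∀ (L M : ℕ) [NeZero L] [NeZero M] (ω : Λ L M → Fin 3 → ℝ),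
        2 * c₀ * ∑ x : Λ L M, ∑ i : Fin 3, (ω x i) ^ 2 ≤
          ∑ s : Λ L M, (-c.sum (fun n a => a * (((∑ w : W r, (n w : ℝ) *
            ((TorusChart.piProdZMod 2 L M).lineSum ω 0 (w.1 : ℕ) s
              + (TorusChart.piProdZMod 2 L M).lineSum ω 1 (w.2.1 : ℕ) (s + (w.1 : ℕ) • (TorusChart.piProdZMod 2 L M).gen 0)
              + (TorusChart.piProdZMod 2 L M).lineSum ω 2 (w.2.2 : ℕ)
                (s + (w.1 : ℕ) • (TorusChart.piProdZMod 2 L M).gen 0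
                  + (w.2.1 : ℕ) • (TorusChart.piProdZMod 2 L M).gen 1))) ^ 2 : ℝ) : ℂ))).re := by
  intro r c c₀ hr hc₀ hN hC L M _ _ ω
  rw [Finset.mul_sum]
  refine Finset.sum_le_sum fun s _ => ?_
  rw [Fin.sum_univ_three]
  exact thinForm_hess_ge_of_values c hr hc₀ hN hC _ (ω s 0) (ω s 1) (ω s 2)
    (by simp) (by simp [TorusChart.lineSum]) (by simp [TorusChart.lineSum]) (by simp [TorusChart.lineSum])

end Summit.HubbardSuperconductivity.HubbardSuperconductivity.Theorems.FSUnfolding
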